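import Summits.CriticalPhenomena.PercolationContinuityZ3.Theorems.PercNearOneGluingNoHeavyLowerTailPendantStripping
import Summits.CriticalPhenomena.PercolationContinuityZ3.Theorems.PercNearOneGluingNoHeavyLowerTailSetGapStability
import Summits.CriticalPhenomena.PercolationContinuityZ3.Theorems.PercNearOneGluingNoHeavyLowerTailCILSubStarReference
import HarnessLib

/-!
# `NoHeavyLowerTail` (stmt-CriticalPhenomena-4575) — pendant blindness, and CIL for an observer with ONE arbitrary light
# Steiner neighbour plus a relay-pendant one

Support file (prover `prim-hp-6`, hull-port cell, observer-set / OES technique; `--supports stmt-CriticalPhenomena-4575`).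
No definitions, no named facts, no sorries.  Continues `…PendantStripping` (`CutObserver.setCS_of_pendantMember`).

Notation: `μ_w = prodBernoulli w` on `Fin n`, relays `A`, level `j`, `π(v)`, lightness `r_w(x) = μ_w{|π(x)| ≤ j}`, CIL mass
`θ_w(v) = μ_w{1 ≤ |π(v)| ≤ j}`, `w ∖ t = fun e => if t ∉ e then w e else 0`.  A vertex `t ∉ A` is a RELAY-PENDANT on `z` if
every positive-weight pair at `t` is `s(t, z)`.

* `CutObserver.reach_iff_avoid_of_pendantStar` — on a star `σ_D` of `t` with `D ⊆ {z}` (every pair at `t` other than possibly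
  `t–z` closed), two vertices `≠ t` are joined iff they are joined without the pairs at `t` (a leaf carries no through-path).
* `CutObserver.measureReal_eq_avoid_of_pendant` — hence every event that, on these stars, is read off `ω ∩ {e | t ∉ e}` has the
  same `μ_w`- and `μ_{w∖t}`-probability ("pendant blindness"); instances: `lightness_eq_of_pendant` (`r_w(x) = r_{w∖t}(x)`,
  `x ≠ t`) and `cilMass_eq_of_pendant` (`θ_w(v) = θ_{w∖t}(v)`, `v ≠ t`).
* (the singleton case `CS({v}, c) ⟸ CIL at v with witness c` is the tree's `SubStar.setCS_singleton_of_cil`, reused here)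
* `cil_of_oneLightAndPendant` — **CIL_j at an observer `o ∉ A` whose light positive-weight neighbours are (at most) one vertex
  `v` and one relay-pendant `t`** (pendant on a relay `z`; `v, t ∉ A`; any number of relay / heavy neighbours; arbitrary graph
  elsewhere): if `c` is a champion of `w ∖ o` and CIL_j holds at `v` in `w ∖ o` with witness `c`, then
  `μ_w{1 ≤ N ≤ j} ≤ μ_w{|π(c)| ≤ j}`.  Proof: `Theorems.cil_of_setGap_deleted` needs the wall for the light stars `{v}`, `{t}`,
  `{v,t}` in `w ∖ o`; `{v}` is CIL at `v`; the stars containing `t` are stripped by `setCS_of_pendantMember`, whose hypotheses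
  in `(w ∖ o) ∖ t` come from those in `w ∖ o` by pendant blindness.  (`Theorems.cil_of_oneLightSteinerNeighbour` is the case
  without `t`; with several pendants iterate the stripping — not spelled out here.)
-/

noncomputable section

namespace Summit.CriticalPhenomena.PercolationContinuityZ3.Theorems

open MeasureTheory Set Literature.Probability.LatticeModels Literature.Probability.Percolation
open scoped Classical BigOperators

variable {n : ℕ}

namespace CutObserver

open KNPreFKG in
/-- **A leaf carries no through-path.**  On a star `σ_D` of `t` with `D ⊆ {z}`, for `x, a ≠ t`:
`x ↔ a` iff `x ↔ a` without the pairs at `t`. [folklore] -/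
theorem reach_iff_avoid_of_pendantStar {ω : BondConfig (Fin n)} {t z : Fin n} {D : Finset (Fin n)}
    (hD : D ⊆ {z}) (hσ : ω ∈ starEvent t (↑D : Set (Fin n))) {x a : Fin n} (hxt : x ≠ t) (hat : a ≠ t) :
    (openGraph ω).Reachable x a ↔ (openGraph (ω ∩ {e | t ∉ e})).Reachable x a := by
  refine ⟨fun h => ?_, fun h => reachable_mono inter_subset_left h⟩
  by_cases hxt' : (openGraph ω).Reachable x t
  · -- through `t`: then both `x` and `a` are joined to `z` off `t`
    obtain ⟨y, hy, hyx⟩ := exists_avoid_of_reachable_star hσ hxt hxt'.symm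
    obtain ⟨y', hy', hya⟩ := exists_avoid_of_reachable_star hσ hat (hxt'.symm.trans h)
    have h1 : y = z := Finset.mem_singleton.1 (hD (Finset.mem_coe.1 hy))
    have h2 : y' = z := Finset.mem_singleton.1 (hD (Finset.mem_coe.1 hy'))
    rw [h1] at hyx
    rw [h2] at hya
    exact hyx.symm.trans hya
  · exact reachable_avoiding_of_not_reachable hxt' h

open KNPreFKG in
/-- **Pendant blindness (transfer).**  Let every positive-weight pair at `t` go to `z ≠ t`.  If an event `E` agrees, on each
star `σ_D` of `t` with `D ⊆ {z}`, with a predicate `P` of the configuration off `t`, then `μ_w(E) = μ_w{ω | P(ω ∩ {e | t ∉ e})}`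
(`= μ_{w∖t}{P}` by `measureReal_preimage_avoid`). [folklore] -/
theorem measureReal_eq_avoid_of_pendant (w : Sym2 (Fin n) → unitInterval) {t z : Fin n} (hzt : z ≠ t)
    (hiso : ∀ u, u ≠ t → u ≠ z → w s(t, u) = 0) (E : Set (BondConfig (Fin n))) (P : BondConfig (Fin n) → Prop)
    (hEP : ∀ D : Finset (Fin n), D ⊆ {z} → ∀ ω ∈ starEvent t (↑D : Set (Fin n)), ω ∈ E ↔ P (ω ∩ {e | t ∉ e})) :
    (prodBernoulli w).real E = (prodBernoulli w).real {ω : BondConfig (Fin n) | P (ω ∩ {e | t ∉ e})} := by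
  have htΓ : t ∉ ({z} : Finset (Fin n)) := by
    rw [Finset.mem_singleton]; exact fun h => hzt h.symm
  have hiso' : ∀ u, u ≠ t → u ∉ ({z} : Finset (Fin n)) → w s(t, u) = 0 := by
    intro u hut huz
    rw [Finset.mem_singleton] at huz
    exact hiso u hut huz
  rw [real_eq_sum_inter_starEvent w {z} t htΓ hiso' E,
    real_eq_sum_inter_starEvent w {z} t htΓ hiso' {ω : BondConfig (Fin n) | P (ω ∩ {e | t ∉ e})}]
  refine Finset.sum_congr rfl fun D hD => ?_
  congr 1
  ext ω
  simp only [mem_inter_iff, mem_setOf_eq]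
  constructor
  · rintro ⟨hE, hσ⟩; exact ⟨(hEP D (Finset.mem_powerset.1 hD) ω hσ).1 hE, hσ⟩
  · rintro ⟨hP, hσ⟩; exact ⟨(hEP D (Finset.mem_powerset.1 hD) ω hσ).2 hP, hσ⟩

/-- **Pendant blindness of lightness.**  With `t ∉ A` a relay-pendant on `z ≠ t` and `x ≠ t`:
`μ_w{|π(x)| ≤ j} = μ_{w∖t}{|π(x)| ≤ j}`. [folklore] -/
theorem lightness_eq_of_pendant (w : Sym2 (Fin n) → unitInterval) (A : Finset (Fin n)) {t z : Fin n} (x : Fin n)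
    (j : ℕ) (htA : t ∉ A) (hzt : z ≠ t) (hxt : x ≠ t) (hiso : ∀ u, u ≠ t → u ≠ z → w s(t, u) = 0) :
    (prodBernoulli w).real {ω : BondConfig (Fin n) | (A.filter fun a => ω ∈ openConn x a).card ≤ j} =
      (prodBernoulli fun e => if e ∈ {e : Sym2 (Fin n) | t ∉ e} then w e else 0).real
        {ξ : BondConfig (Fin n) | (A.filter fun a => ξ ∈ openConn x a).card ≤ j} := by
  rw [← measureReal_preimage_avoid]
  refine measureReal_eq_avoid_of_pendant w hzt hiso _
    (fun ξ => (A.filter fun a => ξ ∈ openConn x a).card ≤ j) fun D hD ω hσ => ?_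
  simp only [mem_setOf_eq]
  have heq : (A.filter fun a => ω ∈ openConn x a) = (A.filter fun a => ω ∩ {e | t ∉ e} ∈ openConn x a) :=
    Finset.filter_congr fun a ha =>
      reach_iff_avoid_of_pendantStar hD hσ hxt (fun h => htA (h ▸ ha))
  rw [heq]

/-- **Pendant blindness of the CIL mass.**  With `t ∉ A` a relay-pendant on `z ≠ t` and `v ≠ t`:
`μ_w{1 ≤ |π(v)| ≤ j} = μ_{w∖t}{1 ≤ |π(v)| ≤ j}`. [folklore] -/
theorem cilMass_eq_of_pendant (w : Sym2 (Fin n) → unitInterval) (A : Finset (Fin n)) {t z : Fin n} (v : Fin n)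
    (j : ℕ) (htA : t ∉ A) (hzt : z ≠ t) (hvt : v ≠ t) (hiso : ∀ u, u ≠ t → u ≠ z → w s(t, u) = 0) :
    (prodBernoulli w).real {ω : BondConfig (Fin n) |
        1 ≤ (A.filter fun a => ω ∈ openConn v a).card ∧ (A.filter fun a => ω ∈ openConn v a).card ≤ j} =
      (prodBernoulli fun e => if e ∈ {e : Sym2 (Fin n) | t ∉ e} then w e else 0).real
        {ξ : BondConfig (Fin n) |
          1 ≤ (A.filter fun a => ξ ∈ openConn v a).card ∧ (A.filter fun a => ξ ∈ openConn v a).card ≤ j} := by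
  rw [← measureReal_preimage_avoid]
  refine measureReal_eq_avoid_of_pendant w hzt hiso _
    (fun ξ => 1 ≤ (A.filter fun a => ξ ∈ openConn v a).card ∧ (A.filter fun a => ξ ∈ openConn v a).card ≤ j)
    fun D hD ω hσ => ?_
  simp only [mem_setOf_eq]
  have heq : (A.filter fun a => ω ∈ openConn v a) = (A.filter fun a => ω ∩ {e | t ∉ e} ∈ openConn v a) :=
    Finset.filter_congr fun a ha =>
      reach_iff_avoid_of_pendantStar hD hσ hvt (fun h => htA (h ▸ ha))
  rw [heq]

/-- **Iterated pendant stripping.**  Let `T ⊆ B` be a set of relay-pendants: each `t ∈ T` has `t ∉ A`, hangs on a vertex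
`z t ∉ T` with `z t ≠ t`, `c ≠ t`, and every positive-weight pair at `t` is `s(t, z t)`; and `r_w(z t) ≤ r_w(c)` for `t ∈ T`.  Write
`w ∖ T = fun e => if (∀ t ∈ T, t ∉ e) then w e else 0`.  Then `CS_{w∖T}(B ∖ T, c)` implies `CS_w(B, c)`.  (Induction on `T` with
`setCS_of_pendantMember`; the hypotheses move from `w` to `w ∖ t` by pendant blindness.) [folklore] -/
theorem setCS_of_pendants (A : Finset (Fin n)) (c : Fin n) (j : ℕ) (z : Fin n → Fin n) (T : Finset (Fin n)) :
    ∀ (w : Sym2 (Fin n) → unitInterval) (B : Finset (Fin n)), T ⊆ B →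
      (∀ t ∈ T, t ∉ A ∧ z t ≠ t ∧ c ≠ t ∧ z t ∉ T) →
      (∀ t ∈ T, ∀ u, u ≠ t → u ≠ z t → w s(t, u) = 0) →
      (∀ t ∈ T, (prodBernoulli w).real {ω : BondConfig (Fin n) | (A.filter fun a => ω ∈ openConn (z t) a).card ≤ j} ≤
        (prodBernoulli w).real {ω : BondConfig (Fin n) | (A.filter fun a => ω ∈ openConn c a).card ≤ j}) →
      ((prodBernoulli fun e => if (∀ t ∈ T, t ∉ e) then w e else 0).real
          {ξ : BondConfig (Fin n) | (∀ x ∈ B \ T, ξ ∉ openConn c x) ∧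
            1 ≤ (A.filter fun a => ∃ x ∈ B \ T, ξ ∈ openConn x a).card ∧
            (A.filter fun a => ∃ x ∈ B \ T, ξ ∈ openConn x a).card ≤ j} ≤
        (prodBernoulli fun e => if (∀ t ∈ T, t ∉ e) then w e else 0).real
          {ξ : BondConfig (Fin n) | (∀ x ∈ B \ T, ξ ∉ openConn c x) ∧
            (A.filter fun a => ξ ∈ openConn c a).card ≤ j}) →
      (prodBernoulli w).real {ω : BondConfig (Fin n) | (∀ x ∈ B, ω ∉ openConn c x) ∧
          1 ≤ (A.filter fun a => ∃ x ∈ B, ω ∈ openConn x a).card ∧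
          (A.filter fun a => ∃ x ∈ B, ω ∈ openConn x a).card ≤ j} ≤
        (prodBernoulli w).real {ω : BondConfig (Fin n) | (∀ x ∈ B, ω ∉ openConn c x) ∧
          (A.filter fun a => ω ∈ openConn c a).card ≤ j} := by
  induction T using Finset.induction_on with
  | empty =>
    intro w B _ _ _ _ hrest
    have hw : (fun e : Sym2 (Fin n) => if (∀ t ∈ (∅ : Finset (Fin n)), t ∉ e) then w e else 0) = w := by
      funext e; simp
    rw [hw, Finset.sdiff_empty] at hrest
    exact hrest
  | @insert t T' htT' ih =>
    intro w B hTB hT hiso hdom hrest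
    have ht : t ∉ A ∧ z t ≠ t ∧ c ≠ t ∧ z t ∉ insert t T' := hT t (Finset.mem_insert_self _ _)
    have htB : t ∈ B := hTB (Finset.mem_insert_self _ _)
    have hisot : ∀ u, u ≠ t → u ≠ z t → w s(t, u) = 0 := hiso t (Finset.mem_insert_self _ _)
    -- the weights with `t` switched off
    set w₁ : Sym2 (Fin n) → unitInterval := fun e => if e ∈ {e : Sym2 (Fin n) | t ∉ e} then w e else 0 with hw₁
    refine setCS_of_pendantMember w A B c t (z t) j htB ht.1 ht.2.1 ht.2.2.1 hisot ?_ ?_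
    · -- domination off `t`, by pendant blindness
      rw [← lightness_eq_of_pendant w A (z t) j ht.1 ht.2.1 ht.2.1 hisot,
        ← lightness_eq_of_pendant w A c j ht.1 ht.2.1 ht.2.2.1 hisot]
      exact hdom t (Finset.mem_insert_self _ _)
    · -- the remaining pendants, in `w₁`, by induction
      refine ih w₁ (B.erase t) ?_ ?_ ?_ ?_ ?_
      · intro t' ht'
        exact Finset.mem_erase.2 ⟨fun h => htT' (h ▸ ht'), hTB (Finset.mem_insert_of_mem ht')⟩
      · intro t' ht'
        obtain ⟨h1, h2, h3, h4⟩ := hT t' (Finset.mem_insert_of_mem ht')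
        exact ⟨h1, h2, h3, fun h => h4 (Finset.mem_insert_of_mem h)⟩
      · intro t' ht' u hut huz
        have h := hiso t' (Finset.mem_insert_of_mem ht') u hut huz
        simp only [hw₁]
        split_ifs
        · exact h
        · rfl
      · intro t' ht'
        obtain ⟨h1, h2, h3, h4⟩ := hT t' (Finset.mem_insert_of_mem ht')
        have hzt : z t' ≠ t := fun h => h4 (h ▸ Finset.mem_insert_self _ _)
        rw [hw₁, ← lightness_eq_of_pendant w A (z t') j ht.1 ht.2.1 hzt hisot,
          ← lightness_eq_of_pendant w A c j ht.1 ht.2.1 ht.2.2.1 hisot]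
        exact hdom t' (Finset.mem_insert_of_mem ht')
      · -- `(w₁ ∖ T') = w ∖ insert t T'` and `(B.erase t) ∖ T' = B ∖ insert t T'`
        have hwT : (fun e : Sym2 (Fin n) => if (∀ t'' ∈ T', t'' ∉ e) then w₁ e else 0) =
            (fun e : Sym2 (Fin n) => if (∀ t'' ∈ insert t T', t'' ∉ e) then w e else 0) := by
          funext e
          simp only [hw₁, mem_setOf_eq, Finset.forall_mem_insert]
          by_cases h1 : t ∉ e <;> by_cases h2 : (∀ t'' ∈ T', t'' ∉ e) <;> simp [h1, h2]
        have hBT : (B.erase t) \ T' = B \ insert t T' := by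
          ext x
          simp only [Finset.mem_sdiff, Finset.mem_erase, Finset.mem_insert, not_or]
          tauto
        rw [hwT, hBT]
        exact hrest

end CutObserver

open CutObserver in
/-- **CIL_j at an observer with one arbitrary light Steiner neighbour and one relay-pendant light neighbour.**
Let `o ∉ A`, `c ∈ A`, `v, t ∉ A` with `v ≠ t`, and `z ∈ A` with `z ≠ t`; write `w₀ = w ∖ o`.  Assume:
(i) `t` is a relay-pendant on `z` away from `o`: `w s(t,u) = 0` for every `u ∉ {t, z, o}`;
(ii) `c` is a level-`j` champion of `w₀` (`r_{w₀}(a) ≤ r_{w₀}(c)` for `a ∈ A`);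
(iii) every LIGHT positive-weight neighbour `y` of `o` (`y ≠ o`, `w s(o,y) ≠ 0`, `r_{w₀}(c) < r_{w₀}(y)`) is `v` or `t`;
(iv) CIL_j at `v` in `w₀` with witness `c`: `θ_{w₀}(v) ≤ r_{w₀}(c)`.
Then `μ_w{1 ≤ N ≤ j} ≤ μ_w{|π(c)| ≤ j}` — the conclusion of `stub_cumulativeIsolation` (crux `NoHeavyLowerTail`,
stmt-CriticalPhenomena-4575) at `o` with witness `c`.  The light stars are `{v}` (CIL at `v`), `{t}`, `{v,t}` (pendant stripping +
pendant blindness + the lonely-cluster exchange at `z`).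
[cite: VandenbergHaggstromKahn2005, Thm. 1.5 (p. 7); KozmaNitzan2024, Thm. 5 (pp. 13–14) — analogue with an extra pendant neighbour] -/
theorem cil_of_oneLightAndPendant (w : Sym2 (Fin n) → unitInterval) (A : Finset (Fin n)) (o c v t z : Fin n) (j : ℕ)
    (hoA : o ∉ A) (hcA : c ∈ A) (hvA : v ∉ A) (htA : t ∉ A) (hvt : v ≠ t) (hzA : z ∈ A) (hzt : z ≠ t)
    (hiso : ∀ u, u ≠ t → u ≠ z → u ≠ o → w s(t, u) = 0)
    (hchamp : ∀ a ∈ A,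
      (prodBernoulli fun e => if e ∈ {e : Sym2 (Fin n) | o ∉ e} then w e else 0).real
          {ξ : BondConfig (Fin n) | (A.filter fun x => ξ ∈ openConn a x).card ≤ j} ≤
        (prodBernoulli fun e => if e ∈ {e : Sym2 (Fin n) | o ∉ e} then w e else 0).real
          {ξ : BondConfig (Fin n) | (A.filter fun x => ξ ∈ openConn c x).card ≤ j})
    (hlight : ∀ y, y ≠ o → w s(o, y) ≠ 0 →
      (prodBernoulli fun e => if e ∈ {e : Sym2 (Fin n) | o ∉ e} then w e else 0).real
          {ξ : BondConfig (Fin n) | (A.filter fun x => ξ ∈ openConn c x).card ≤ j} <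
        (prodBernoulli fun e => if e ∈ {e : Sym2 (Fin n) | o ∉ e} then w e else 0).real
          {ξ : BondConfig (Fin n) | (A.filter fun x => ξ ∈ openConn y x).card ≤ j} → y = v ∨ y = t)
    (hv : (prodBernoulli fun e => if e ∈ {e : Sym2 (Fin n) | o ∉ e} then w e else 0).real
        {ξ : BondConfig (Fin n) |
          1 ≤ (A.filter fun x => ξ ∈ openConn v x).card ∧ (A.filter fun x => ξ ∈ openConn v x).card ≤ j} ≤
      (prodBernoulli fun e => if e ∈ {e : Sym2 (Fin n) | o ∉ e} then w e else 0).real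
        {ξ : BondConfig (Fin n) | (A.filter fun x => ξ ∈ openConn c x).card ≤ j}) :
    (prodBernoulli w).real {ω : BondConfig (Fin n) |
        1 ≤ (A.filter fun x => ω ∈ openConn o x).card ∧ (A.filter fun x => ω ∈ openConn o x).card ≤ j} ≤
      (prodBernoulli w).real {ω : BondConfig (Fin n) | (A.filter fun x => ω ∈ openConn c x).card ≤ j} := by
  -- the observer-deleted weights and the pendant hypotheses there
  set w₀ : Sym2 (Fin n) → unitInterval := fun e => if e ∈ {e : Sym2 (Fin n) | o ∉ e} then w e else 0 with hw₀
  have hct : c ≠ t := fun h => htA (h ▸ hcA)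
  have hiso₀ : ∀ u, u ≠ t → u ≠ z → w₀ s(t, u) = 0 := by
    intro u hut huz
    by_cases huo : u = o
    · subst huo
      simp only [hw₀, mem_setOf_eq, Sym2.mem_iff, or_true, not_true_eq_false, if_false]
    · have h := hiso u hut huz huo
      simp only [hw₀]
      split_ifs
      · exact h
      · rfl
  refine cil_of_setGap_deleted w A o c j hoA hcA ?_
  intro B hBne hB
  -- members of `B` are `v` or `t`
  have hBvt : ∀ y ∈ B, y = v ∨ y = t := fun y hy =>
    hlight y (hB y hy).1 (hB y hy).2.1 (hB y hy).2.2
  -- CS of `{v}` in `w₀` and in `w₀ ∖ t`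
  have hCSv : (prodBernoulli w₀).real {ω : BondConfig (Fin n) | (∀ x ∈ ({v} : Finset (Fin n)), ω ∉ openConn c x) ∧
        1 ≤ (A.filter fun a => ∃ x ∈ ({v} : Finset (Fin n)), ω ∈ openConn x a).card ∧
        (A.filter fun a => ∃ x ∈ ({v} : Finset (Fin n)), ω ∈ openConn x a).card ≤ j} ≤
      (prodBernoulli w₀).real {ω : BondConfig (Fin n) | (∀ x ∈ ({v} : Finset (Fin n)), ω ∉ openConn c x) ∧
        (A.filter fun a => ω ∈ openConn c a).card ≤ j} :=
    SubStar.setCS_singleton_of_cil w₀ A v c j hcA hv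
  by_cases htB : t ∈ B
  · -- strip the pendant `t`
    refine setCS_of_pendantMember w₀ A B c t z j htB htA hzt hct hiso₀ ?_ ?_
    · -- `z` no lighter than `c` off `t`: pendant blindness + championship
      rw [← lightness_eq_of_pendant w₀ A z j htA hzt hzt hiso₀, ← lightness_eq_of_pendant w₀ A c j htA hzt hct hiso₀]
      exact hchamp z hzA
    · -- the rest `B.erase t ⊆ {v}`
      by_cases hvB : v ∈ B
      · have hBe : B.erase t = {v} := by
          ext y
          rw [Finset.mem_erase, Finset.mem_singleton]
          constructor
          · rintro ⟨hyt, hy⟩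
            rcases hBvt y hy with h | h
            · exact h
            · exact absurd h hyt
          · rintro rfl; exact ⟨hvt, hvB⟩
        rw [hBe]
        refine SubStar.setCS_singleton_of_cil _ A v c j hcA ?_
        rw [← cilMass_eq_of_pendant w₀ A v j htA hzt hvt hiso₀, ← lightness_eq_of_pendant w₀ A c j htA hzt hct hiso₀]
        exact hv
      · have hBe : B.erase t = ∅ := by
          ext y
          rw [Finset.mem_erase]
          simp only [Finset.notMem_empty, iff_false, not_and]
          intro hyt hy
          rcases hBvt y hy with h | h
          · exact hvB (h ▸ hy)
          · exact hyt h
        rw [hBe]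
        have hempty : ∀ ξ : BondConfig (Fin n),
            ¬ (1 ≤ (A.filter fun a => ∃ x ∈ (∅ : Finset (Fin n)), ξ ∈ openConn x a).card) := by
          intro ξ h
          rw [Finset.filter_false_of_mem (fun a _ => by simp), Finset.card_empty] at h
          exact absurd h (by omega)
        refine le_trans (le_of_eq ?_) measureReal_nonneg
        have h0 : ∀ (v : Sym2 (Fin n) → unitInterval) (S : Set (BondConfig (Fin n))), (∀ ξ, ξ ∉ S) →
            (prodBernoulli v).real S = 0 := fun v S hS => by
          rw [Set.eq_empty_iff_forall_notMem.2 hS, measureReal_empty]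
        refine h0 _ _ ?_
        intro ξ hξ
        exact hempty ξ hξ.2.1
  · -- `B = {v}`
    have hB' : B = {v} := by
      obtain ⟨y, hy⟩ := hBne
      have hyv : y = v := by
        rcases hBvt y hy with h | h
        · exact h
        · exact absurd (h ▸ hy) htB
      subst hyv
      refine Finset.eq_singleton_iff_unique_mem.2 ⟨hy, fun x hx => ?_⟩
      rcases hBvt x hx with h | h
      · exact h
      · exact absurd (h ▸ hx) htB
    subst hB'
    exact hCSv

end Summit.CriticalPhenomena.PercolationContinuityZ3.Theorems

end
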